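import Mathlib
import Summits.PneNP.PneNP.Theorems.PstarExpandingModel
import Summits.PneNP.PneNP.Theorems.PstarUniformRepeats

/-!
# Random typed `P⋆` instances: few output pairs share two variables (w23d supply, the alteration count)

FRONTIER range-avoidance ladder (cell `pnp-ideate`, residue w23d of ROUNDS 21–23; restricted-model combinatorics — nothing here
bears on `P` versus `NP`).

`PstarSALevel.SimpleOverlap` (no two outputs share two variables) is the SDP-layer hypothesis of the hubs T21.1c / T23.3; the
first-moment existence theorems control boundary expansion only.  In the R21 model `PstarExpandingModel.Outcome N m`, two typed
outputs share two variables only if their XOR pairs coincide as sets, or their AND pairs do, or they share one XOR and one AND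
variable (`card_inter_varSet_inst`, `card_ovX_le`: `≤ 20N²` partners per output value), so the number `#ovl ω` of output pairs
sharing two variables has total mass `Σ_ω #ovl ω ≤ C(m,2)·20N²·|X|·|X|^{m−2}` (`sum_card_ovl_le`); MARKOV AS COUNTING
(`card_many_mul_le`) gives `two_mul_card_many_le`: fewer than half of the outcomes have more than `80K²` such pairs (`m ≤ K·N`,
`N ≥ 2`).  Deleting one output per offending pair (`PstarSubInstance`) then yields simple overlaps — the alteration step.
-/

set_option linter.dupNamespace false -- `Summit.PneNP.PneNP.…`: summit = sub-problem name (D-0017 single-conjunct layout)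

open Finset Literature.Computability.Complexity
open Summit.PneNP.PneNP.Theorems.PstarSALevel (varSet)
open Summit.PneNP.PneNP.Theorems.PstarExpandingModel (DPair Outcome inst slots castAdd_ne_natAdd)
open Summit.PneNP.PneNP.Theorems.PstarUniformRepeats (pkey pfib card_pfib pkey_not_isDiag card_DPair)

namespace Summit.PneNP.PneNP.Theorems.PstarOverlapCount

variable {N m : ℕ}

/-- One output value: an XOR pair and an AND pair. -/
abbrev X (N : ℕ) : Type := DPair N × DPair N

/-- The XOR variables of an output value. -/
def xs (q : X N) : Finset (Fin N) := {q.1.1.1, q.1.1.2}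

/-- The AND variables of an output value. -/
def as (q : X N) : Finset (Fin N) := {q.2.1.1, q.2.1.2}

/-- The variable set of output `j` of `inst ω`: left copy of its XOR pair, right copy of its AND pair. -/
theorem varSet_inst (ω : Outcome N m) (j : Fin m) :
    varSet (inst ω) j = (xs (ω j)).image (Fin.castAdd N) ∪ (as (ω j)).image (Fin.natAdd N) := by
  ext v
  simp only [PstarSALevel.varSet, Finset.mem_image, Finset.mem_univ, true_and, Finset.mem_union, xs, as,
    Finset.mem_insert, Finset.mem_singleton]
  constructor
  · rintro ⟨s, hs⟩
    change slots N (ω j) s = v at hs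
    fin_cases s
    · exact Or.inl ⟨_, Or.inl rfl, hs⟩
    · exact Or.inl ⟨_, Or.inr rfl, hs⟩
    · exact Or.inr ⟨_, Or.inl rfl, hs⟩
    · exact Or.inr ⟨_, Or.inr rfl, hs⟩
  · rintro (⟨a, rfl | rfl, rfl⟩ | ⟨c, rfl | rfl, rfl⟩)
    · exact ⟨0, rfl⟩
    · exact ⟨1, rfl⟩
    · exact ⟨2, rfl⟩
    · exact ⟨3, rfl⟩

/-- Intersections of typed variable sets split into the XOR part and the AND part. -/
theorem card_inter_split (A A' B B' : Finset (Fin N)) :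
    ((A.image (Fin.castAdd N) ∪ B.image (Fin.natAdd N)) ∩ (A'.image (Fin.castAdd N) ∪ B'.image (Fin.natAdd N))).card =
      (A ∩ A').card + (B ∩ B').card := by
  have heq : (A.image (Fin.castAdd N) ∪ B.image (Fin.natAdd N)) ∩ (A'.image (Fin.castAdd N) ∪ B'.image (Fin.natAdd N)) =
      (A ∩ A').image (Fin.castAdd N) ∪ (B ∩ B').image (Fin.natAdd N) := by
    ext v
    simp only [mem_inter, mem_union, mem_image]
    constructor
    · rintro ⟨h1 | h1, h2 | h2⟩
      · obtain ⟨a, ha, rfl⟩ := h1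
        obtain ⟨a', ha', he⟩ := h2
        exact Or.inl ⟨a, ⟨ha, by rw [Fin.castAdd_injective _ _ he.symm]; exact ha'⟩, rfl⟩
      · obtain ⟨a, ha, rfl⟩ := h1
        obtain ⟨c, -, he⟩ := h2
        exact absurd he.symm (castAdd_ne_natAdd a c)
      · obtain ⟨c, hc, rfl⟩ := h1
        obtain ⟨a, -, he⟩ := h2
        exact absurd he (castAdd_ne_natAdd a c)
      · obtain ⟨c, hc, rfl⟩ := h1
        obtain ⟨c', hc', he⟩ := h2
        exact Or.inr ⟨c, ⟨hc, by rw [Fin.natAdd_injective _ _ he.symm]; exact hc'⟩, rfl⟩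
    · rintro (⟨a, ha, rfl⟩ | ⟨c, hc, rfl⟩)
      · exact ⟨Or.inl ⟨a, ha.1, rfl⟩, Or.inl ⟨a, ha.2, rfl⟩⟩
      · exact ⟨Or.inr ⟨c, hc.1, rfl⟩, Or.inr ⟨c, hc.2, rfl⟩⟩
  rw [heq, card_union_of_disjoint, card_image_of_injective _ (Fin.castAdd_injective _ _),
    card_image_of_injective _ (Fin.natAdd_injective _ _)]
  rw [disjoint_left]
  rintro v hv hv'
  obtain ⟨a, -, rfl⟩ := mem_image.1 hv
  obtain ⟨c, -, hc⟩ := mem_image.1 hv'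
  exact castAdd_ne_natAdd a c hc.symm

/-- **Shared variables of two outputs** = shared XOR variables + shared AND variables. -/
theorem card_inter_varSet_inst (ω : Outcome N m) (j j' : Fin m) :
    (varSet (inst ω) j ∩ varSet (inst ω) j').card = (xs (ω j) ∩ xs (ω j')).card + (as (ω j) ∩ as (ω j')).card := by
  rw [varSet_inst, varSet_inst, card_inter_split]

/-! ## Output values sharing two variables with a fixed one -/

/-- Two XOR (or AND) pairs meeting in two points have the same key. -/
theorem pkey_eq_of_two_le {p p' : DPair N} (h : 2 ≤ (({p.1.1, p.1.2} : Finset (Fin N)) ∩ {p'.1.1, p'.1.2}).card) :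
    pkey p' = pkey p := by
  have hsub : ({p'.1.1, p'.1.2} : Finset (Fin N)) ⊆ {p.1.1, p.1.2} := by
    have h1 : (({p.1.1, p.1.2} : Finset (Fin N)) ∩ {p'.1.1, p'.1.2}) = {p'.1.1, p'.1.2} := by
      apply Finset.eq_of_subset_of_card_le inter_subset_right
      exact (card_insert_le _ _).trans (by rw [card_singleton]; exact h)
    rw [← h1]; exact inter_subset_left
  have ha : p'.1.1 ∈ ({p.1.1, p.1.2} : Finset (Fin N)) := hsub (by simp)
  have hb : p'.1.2 ∈ ({p.1.1, p.1.2} : Finset (Fin N)) := hsub (by simp)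
  rw [mem_insert, mem_singleton] at ha hb
  unfold PstarUniformRepeats.pkey
  rw [Sym2.eq_iff]
  have hne := p'.2
  rcases ha with ha | ha <;> rcases hb with hb | hb <;>
    first | exact absurd (ha.trans hb.symm) hne | exact Or.inl ⟨ha, hb⟩ | exact Or.inr ⟨ha, hb⟩

/-- Pairs with one coordinate in a given small set: at most `|S|·N` of them for each coordinate. -/
theorem card_filter_fst_mem_le (S : Finset (Fin N)) :
    (univ.filter fun p : DPair N => p.1.1 ∈ S).card ≤ S.card * N := by
  have h : (univ.filter fun p : DPair N => p.1.1 ∈ S).card ≤ (S ×ˢ (univ : Finset (Fin N))).card := by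
    refine card_le_card_of_injOn (fun p => p.1) (fun p hp => ?_) (fun p _ p' _ h => Subtype.ext h)
    rw [mem_coe, mem_filter] at hp
    exact mem_coe.2 (mem_product.2 ⟨hp.2, mem_univ _⟩)
  rwa [card_product, card_univ, Fintype.card_fin] at h

/-- Symmetric version for the second coordinate. -/
theorem card_filter_snd_mem_le (S : Finset (Fin N)) :
    (univ.filter fun p : DPair N => p.1.2 ∈ S).card ≤ S.card * N := by
  have h : (univ.filter fun p : DPair N => p.1.2 ∈ S).card ≤ ((univ : Finset (Fin N)) ×ˢ S).card := by
    refine card_le_card_of_injOn (fun p => p.1) (fun p hp => ?_) (fun p _ p' _ h => Subtype.ext h)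
    rw [mem_coe, mem_filter] at hp
    exact mem_coe.2 (mem_product.2 ⟨mem_univ _, hp.2⟩)
  rw [card_product, card_univ, Fintype.card_fin] at h
  rw [mul_comm]; exact h

/-- Pairs meeting a two-element set: at most `4N`. -/
theorem card_filter_meets_le (a b : Fin N) :
    (univ.filter fun p : DPair N => p.1.1 ∈ ({a, b} : Finset (Fin N)) ∨ p.1.2 ∈ ({a, b} : Finset (Fin N))).card ≤ 4 * N := by
  rw [filter_or]
  refine (card_union_le _ _).trans ?_
  have h1 := card_filter_fst_mem_le (N := N) {a, b}
  have h2 := card_filter_snd_mem_le (N := N) {a, b}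
  have h3 : ({a, b} : Finset (Fin N)).card ≤ 2 := card_insert_le _ _
  nlinarith

/-- The output values sharing at least two variables with `q`. -/
def ovX (q : X N) : Finset (X N) := univ.filter fun q' => 2 ≤ (xs q ∩ xs q').card + (as q ∩ as q').card

/-- **At most `20N²` output values share two variables with a given one**: same XOR key (`2·K₀`), same AND key (`2·K₀`),
or one shared XOR and one shared AND variable (`≤ (4N)²`), with `K₀ = N² − N ≤ N²`. -/
theorem card_ovX_le (q : X N) : (ovX q).card ≤ 20 * N ^ 2 := by
  classical
  set T₁ : Finset (X N) := univ.filter fun q' => pkey q'.1 = pkey q.1 with hT₁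
  set T₂ : Finset (X N) := univ.filter fun q' => pkey q'.2 = pkey q.2 with hT₂
  set H₁ : Finset (DPair N) := univ.filter fun p : DPair N =>
    p.1.1 ∈ ({q.1.1.1, q.1.1.2} : Finset (Fin N)) ∨ p.1.2 ∈ ({q.1.1.1, q.1.1.2} : Finset (Fin N)) with hH₁
  set H₂ : Finset (DPair N) := univ.filter fun p : DPair N =>
    p.1.1 ∈ ({q.2.1.1, q.2.1.2} : Finset (Fin N)) ∨ p.1.2 ∈ ({q.2.1.1, q.2.1.2} : Finset (Fin N)) with hH₂
  have hsub : ovX q ⊆ T₁ ∪ T₂ ∪ H₁ ×ˢ H₂ := by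
    intro q' hq'
    simp only [ovX, mem_filter, mem_univ, true_and] at hq'
    rw [mem_union, mem_union]
    by_cases hx : 2 ≤ (xs q ∩ xs q').card
    · exact Or.inl (Or.inl (mem_filter.2 ⟨mem_univ _, pkey_eq_of_two_le hx⟩))
    by_cases ha : 2 ≤ (as q ∩ as q').card
    · exact Or.inl (Or.inr (mem_filter.2 ⟨mem_univ _, pkey_eq_of_two_le ha⟩))
    right
    have hx1 : 1 ≤ (xs q ∩ xs q').card := by omega
    have ha1 : 1 ≤ (as q ∩ as q').card := by omega
    obtain ⟨u, hu⟩ := card_pos.1 hx1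
    obtain ⟨w, hw⟩ := card_pos.1 ha1
    rw [mem_inter] at hu hw
    rw [mem_product]
    refine ⟨mem_filter.2 ⟨mem_univ _, ?_⟩, mem_filter.2 ⟨mem_univ _, ?_⟩⟩
    · have h2 : u = q'.1.1.1 ∨ u = q'.1.1.2 := by simpa [xs] using hu.2
      have h1 : u ∈ ({q.1.1.1, q.1.1.2} : Finset (Fin N)) := hu.1
      rcases h2 with rfl | rfl
      · exact Or.inl h1
      · exact Or.inr h1
    · have h2 : w = q'.2.1.1 ∨ w = q'.2.1.2 := by simpa [as] using hw.2
      have h1 : w ∈ ({q.2.1.1, q.2.1.2} : Finset (Fin N)) := hw.1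
      rcases h2 with rfl | rfl
      · exact Or.inl h1
      · exact Or.inr h1
  -- the three counts
  have hK : Fintype.card (DPair N) ≤ N ^ 2 := by rw [card_DPair, sq]; exact Nat.sub_le _ _
  have hT₁c : T₁.card ≤ 2 * N ^ 2 := by
    have he : T₁ = pfib (pkey q.1) ×ˢ (univ : Finset (DPair N)) := by
      ext q'; simp [hT₁, PstarUniformRepeats.pfib]
    rw [he, card_product, card_pfib (pkey_not_isDiag q.1), card_univ]
    omega
  have hT₂c : T₂.card ≤ 2 * N ^ 2 := by
    have he : T₂ = (univ : Finset (DPair N)) ×ˢ pfib (pkey q.2) := by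
      ext q'; simp [hT₂, PstarUniformRepeats.pfib]
    rw [he, card_product, card_pfib (pkey_not_isDiag q.2), card_univ]
    omega
  have hHc : (H₁ ×ˢ H₂).card ≤ 16 * N ^ 2 := by
    rw [card_product]
    have h1 := card_filter_meets_le (N := N) q.1.1.1 q.1.1.2
    have h2 := card_filter_meets_le (N := N) q.2.1.1 q.2.1.2
    calc H₁.card * H₂.card ≤ (4 * N) * (4 * N) := Nat.mul_le_mul h1 h2
      _ = 16 * N ^ 2 := by ring
  calc (ovX q).card ≤ (T₁ ∪ T₂ ∪ H₁ ×ˢ H₂).card := card_le_card hsub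
    _ ≤ (T₁ ∪ T₂).card + (H₁ ×ˢ H₂).card := card_union_le _ _
    _ ≤ T₁.card + T₂.card + (H₁ ×ˢ H₂).card := Nat.add_le_add_right (card_union_le _ _) _
    _ ≤ 20 * N ^ 2 := by omega

/-! ## Overlapping pairs of an outcome and their total number -/

/-- The output pairs `j < j'` of `inst ω` sharing at least two variables. -/
def ovl (ω : Outcome N m) : Finset (Fin m × Fin m) :=
  univ.filter fun p => p.1 < p.2 ∧ 2 ≤ (varSet (inst ω) p.1 ∩ varSet (inst ω) p.2).card

/-- The cylinder of outcomes with two prescribed output values. -/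
def cyl2 (j j' : Fin m) (q q' : X N) : Finset (Outcome N m) :=
  Fintype.piFinset fun i => if i = j then {q} else if i = j' then {q'} else univ

/-- Its size: `|X|^{m−2}` for `j ≠ j'`. -/
theorem card_cyl2 {j j' : Fin m} (hjj' : j ≠ j') (q q' : X N) :
    (cyl2 j j' q q').card = Fintype.card (X N) ^ (m - 2) := by
  classical
  unfold cyl2
  rw [Fintype.card_piFinset]
  have h : ∀ i : Fin m, (if i = j then ({q} : Finset (X N)) else if i = j' then {q'} else univ).card =
      if i ∈ ({j, j'} : Finset (Fin m)) then 1 else Fintype.card (X N) := by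
    intro i
    by_cases h1 : i = j
    · simp [h1]
    · by_cases h2 : i = j'
      · simp [h2, hjj'.symm]
      · simp [h1, h2]
  simp_rw [h]
  rw [prod_ite, prod_const_one, one_mul, prod_const]
  congr 1
  rw [filter_not, filter_mem_eq_inter, univ_inter, card_univ_sdiff, Fintype.card_fin, card_pair hjj']

/-- The outcomes whose outputs `j ≠ j'` share two variables number at most `20N² · |X| · |X|^{m−2}`. -/
theorem card_overlap_le {j j' : Fin m} (hjj' : j ≠ j') :
    (univ.filter fun ω : Outcome N m => 2 ≤ (varSet (inst ω) j ∩ varSet (inst ω) j').card).card ≤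
      20 * N ^ 2 * Fintype.card (X N) * Fintype.card (X N) ^ (m - 2) := by
  classical
  have hsub : (univ.filter fun ω : Outcome N m => 2 ≤ (varSet (inst ω) j ∩ varSet (inst ω) j').card) ⊆
      (univ : Finset (X N)).biUnion fun q => (ovX q).biUnion fun q' => cyl2 j j' q q' := by
    intro ω hω
    rw [mem_filter] at hω
    rw [mem_biUnion]
    refine ⟨ω j, mem_univ _, mem_biUnion.2 ⟨ω j', ?_, ?_⟩⟩
    · simp only [ovX, mem_filter, mem_univ, true_and]
      rw [← card_inter_varSet_inst]
      exact hω.2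
    · unfold cyl2
      rw [Fintype.mem_piFinset]
      intro i
      by_cases h1 : i = j
      · subst h1; simp
      · by_cases h2 : i = j'
        · subst h2; simp [h1]
        · simp [h1, h2]
  refine (card_le_card hsub).trans (card_biUnion_le.trans ?_)
  have hq : ∀ q ∈ (univ : Finset (X N)), ((ovX q).biUnion fun q' => cyl2 j j' q q').card ≤
      20 * N ^ 2 * Fintype.card (X N) ^ (m - 2) := by
    intro q _
    refine card_biUnion_le.trans ?_
    rw [sum_congr rfl fun q' _ => card_cyl2 hjj' q q', sum_const, smul_eq_mul]
    exact Nat.mul_le_mul_right _ (card_ovX_le q)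
  refine (sum_le_sum hq).trans ?_
  rw [sum_const, smul_eq_mul, card_univ]
  ring_nf
  exact le_rfl

/-- **Total mass of overlapping pairs**: `Σ_ω #ovl ω ≤ C(m,2) · 20N² · |X| · |X|^{m−2}`. -/
theorem sum_card_ovl_le :
    ∑ ω : Outcome N m, (ovl ω).card ≤ m.choose 2 * (20 * N ^ 2 * Fintype.card (X N) * Fintype.card (X N) ^ (m - 2)) := by
  classical
  have h1 : ∀ ω : Outcome N m, (ovl ω).card =
      ∑ p ∈ (univ : Finset (Fin m × Fin m)).filter (fun p => p.1 < p.2),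
        if 2 ≤ (varSet (inst ω) p.1 ∩ varSet (inst ω) p.2).card then 1 else 0 := by
    intro ω
    rw [ovl, ← filter_filter, card_filter]
  simp_rw [h1]
  rw [sum_comm]
  have h2 : ∀ p ∈ (univ : Finset (Fin m × Fin m)).filter (fun p => p.1 < p.2),
      (∑ ω : Outcome N m, if 2 ≤ (varSet (inst ω) p.1 ∩ varSet (inst ω) p.2).card then 1 else 0) ≤
        20 * N ^ 2 * Fintype.card (X N) * Fintype.card (X N) ^ (m - 2) := by
    intro p hp
    rw [mem_filter] at hp
    rw [← card_filter]
    exact card_overlap_le (ne_of_lt hp.2)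
  refine (sum_le_sum h2).trans ?_
  rw [sum_const, smul_eq_mul]
  refine Nat.mul_le_mul_right _ ?_
  -- `#{(j, j') : j < j'} ≤ C(m, 2)` (inject into the off-diagonal unordered pairs)
  have h : ((univ : Finset (Fin m × Fin m)).filter fun p => p.1 < p.2).card ≤
      ((univ : Finset (Sym2 (Fin m))).filter fun b => ¬b.IsDiag).card := by
    refine card_le_card_of_injOn (fun p => s(p.1, p.2)) (fun p hp => ?_) (fun p hp p' hp' h => ?_)
    · rw [mem_coe, mem_filter] at hp
      rw [mem_coe, mem_filter, Sym2.mk_isDiag_iff]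
      exact ⟨mem_univ _, ne_of_lt hp.2⟩
    · rw [mem_coe, mem_filter] at hp hp'
      rcases Sym2.eq_iff.1 h with ⟨h1, h2⟩ | ⟨h1, h2⟩
      · exact Prod.ext h1 h2
      · exfalso
        have a1 := hp.2
        have a2 := hp'.2
        rw [h1, h2] at a1
        exact lt_asymm a1 a2
  refine h.trans (le_of_eq ?_)
  rw [← Fintype.card_subtype, Sym2.card_subtype_not_diag, Fintype.card_fin]

/-! ## Markov as counting -/

/-- **Markov**: `#{ω : B < #ovl ω} · (B + 1) ≤ Σ_ω #ovl ω`. -/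
theorem card_many_mul_le (B : ℕ) :
    (univ.filter fun ω : Outcome N m => B < (ovl ω).card).card * (B + 1) ≤ ∑ ω : Outcome N m, (ovl ω).card := by
  classical
  rw [← smul_eq_mul, ← sum_const]
  calc ∑ ω ∈ univ.filter (fun ω : Outcome N m => B < (ovl ω).card), (B + 1)
      ≤ ∑ ω ∈ univ.filter (fun ω : Outcome N m => B < (ovl ω).card), (ovl ω).card :=
        sum_le_sum fun ω hω => (mem_filter.1 hω).2
    _ ≤ ∑ ω : Outcome N m, (ovl ω).card :=
        sum_le_sum_of_subset_of_nonneg (filter_subset _ _) fun _ _ _ => Nat.zero_le _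

/-- `|X| = (N² − N)²` and `4·|X| ≥ N⁴` for `N ≥ 2`. -/
theorem pow_four_le_card_X (hN : 2 ≤ N) : N ^ 4 ≤ 4 * Fintype.card (X N) := by
  have h : Fintype.card (X N) = (N * N - N) * (N * N - N) := by
    rw [Fintype.card_prod, card_DPair]
  rw [h]
  have h2 : N * N - N + (N * N - N) ≥ N * N := by
    have : N + N ≤ N * N := by nlinarith
    omega
  nlinarith

/-- The number of outcomes is `|X|^m`. -/
theorem card_Outcome_X : Fintype.card (Outcome N m) = Fintype.card (X N) ^ m := by
  rw [Fintype.card_fun, Fintype.card_fin]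

/-- **Fewer than half of the outcomes have more than `80K²` overlapping pairs** (`m ≤ K·N`, `N ≥ 2`):
`2 · #{ω : 80K² < #ovl ω} ≤ #Outcome`. -/
theorem two_mul_card_many_le (K : ℕ) (hN : 2 ≤ N) (hm : m ≤ K * N) :
    2 * (univ.filter fun ω : Outcome N m => 80 * K ^ 2 < (ovl ω).card).card ≤ Fintype.card (Outcome N m) := by
  classical
  set Xc := Fintype.card (X N) with hXc
  set M := (univ.filter fun ω : Outcome N m => 80 * K ^ 2 < (ovl ω).card).card with hM
  have h1 := card_many_mul_le (N := N) (m := m) (80 * K ^ 2)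
  have h2 := sum_card_ovl_le (N := N) (m := m)
  have hX4 := pow_four_le_card_X hN
  rcases lt_or_ge m 2 with hm2 | hm2
  · -- fewer than two outputs: no pairs at all
    have h0 : M = 0 := by
      rw [hM, card_eq_zero, filter_eq_empty_iff]
      intro ω _ hlt
      have hz : (ovl ω).card = 0 := by
        rw [card_eq_zero, ovl, filter_eq_empty_iff]
        intro p _ hp
        have a := p.1.isLt
        have b := p.2.isLt
        have c := Fin.lt_def.1 hp.1
        omega
      omega
    rw [h0]; exact Nat.zero_le _
  · -- `2M·(80K²+1) ≤ 2·C(m,2)·20N²·Xc·Xc^{m−2} ≤ 20K²·N⁴·Xc·Xc^{m−2} ≤ 80K²·Xc²·Xc^{m−2}` and `#Ω = Xc²·Xc^{m−2}`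
    have hΩ : Fintype.card (Outcome N m) = Xc * (Xc * Xc ^ (m - 2)) := by
      rw [card_Outcome_X, ← hXc, ← pow_succ', ← pow_succ']; congr 1; omega
    rw [hΩ]
    set T := Xc * Xc ^ (m - 2) with hT
    have h3 : M * (80 * K ^ 2 + 1) ≤ m.choose 2 * (20 * N ^ 2 * Xc * Xc ^ (m - 2)) := h1.trans h2
    have h4 : 2 * m.choose 2 ≤ K ^ 2 * N ^ 2 := by
      have : 2 * m.choose 2 ≤ m * m := by
        rw [Nat.choose_two_right]
        have := Nat.div_mul_le_self (m * (m - 1)) 2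
        nlinarith [Nat.sub_le m 1]
      calc 2 * m.choose 2 ≤ m * m := this
        _ ≤ (K * N) * (K * N) := Nat.mul_le_mul hm hm
        _ = K ^ 2 * N ^ 2 := by ring
    have e1 : 2 * M * (80 * K ^ 2 + 1) ≤ 2 * m.choose 2 * (20 * N ^ 2) * T := by
      have := Nat.mul_le_mul_left 2 h3
      have e : 2 * (m.choose 2 * (20 * N ^ 2 * Xc * Xc ^ (m - 2))) = 2 * m.choose 2 * (20 * N ^ 2) * T := by
        rw [hT]; ring
      rw [e] at this
      calc 2 * M * (80 * K ^ 2 + 1) = 2 * (M * (80 * K ^ 2 + 1)) := by ring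
        _ ≤ _ := this
    have e2 : 2 * m.choose 2 * (20 * N ^ 2) * T ≤ K ^ 2 * N ^ 2 * (20 * N ^ 2) * T :=
      Nat.mul_le_mul_right _ (Nat.mul_le_mul_right _ h4)
    have e3 : K ^ 2 * N ^ 2 * (20 * N ^ 2) * T = 20 * K ^ 2 * N ^ 4 * T := by ring
    have e4 : 20 * K ^ 2 * N ^ 4 * T ≤ 20 * K ^ 2 * (4 * Xc) * T :=
      Nat.mul_le_mul_right _ (Nat.mul_le_mul_left _ hX4)
    have e5 : 20 * K ^ 2 * (4 * Xc) * T = 80 * K ^ 2 * (Xc * T) := by ring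
    have e6 : 80 * K ^ 2 * (Xc * T) ≤ (Xc * T) * (80 * K ^ 2 + 1) := by nlinarith
    have hfin : 2 * M * (80 * K ^ 2 + 1) ≤ (Xc * T) * (80 * K ^ 2 + 1) := by
      calc 2 * M * (80 * K ^ 2 + 1) ≤ 2 * m.choose 2 * (20 * N ^ 2) * T := e1
        _ ≤ K ^ 2 * N ^ 2 * (20 * N ^ 2) * T := e2
        _ = 20 * K ^ 2 * N ^ 4 * T := e3
        _ ≤ 20 * K ^ 2 * (4 * Xc) * T := e4
        _ = 80 * K ^ 2 * (Xc * T) := e5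
        _ ≤ (Xc * T) * (80 * K ^ 2 + 1) := e6
    exact Nat.le_of_mul_le_mul_right hfin (by positivity)

end Summit.PneNP.PneNP.Theorems.PstarOverlapCount
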